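import Mathlib
import Summits.NavierStokesRegularity.NavierStokesRegularity.Theorems.FilamentSkeletonRssStadiumQuarterDescentBound
import Summits.NavierStokesRegularity.NavierStokesRegularity.Theorems.FilamentSkeletonRssStadiumQuarterPlateauBound
import Summits.NavierStokesRegularity.NavierStokesRegularity.Theorems.FilamentSkeletonRssStadiumQuarterOwnFeet

/-!
# Route `FilamentSkeletonRss` · cruxes `SkeletonJ1L` (stmt-NavierStokesRegularity-23296, registered stub `stub_tangentSkeletonL` ≡
# `TangentSkeletonNearStraightL`, stmt-23320) · line `child_tangent_analytic_strip_L` (b0b56c52900dd90a), stub `stub_stripPropagation` —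
# assembly for `rcore`: THE EXPLICIT BOUND OF THE SYMMETRIC QUARTER-WIDTH TENT FIELD (own term), `O(log hs/hs)`

For a target `z` of the quarter stadium `Q = {|Im z| < hs/4, |Re z − cc| < L + hs/4}` the own-filament tent field (vertex map `V`, kernels `f`, `g` by
their defining equations, as in `Theorems.StadiumTentNhds`) is bounded by an EXPLICIT `B_tent(hs, κ, Λ)`:
two feet `≤ 160·π/(hs/2)` each (`Theorems.StadiumQuarterOwnFeet`), two sloped segments `≤ ((0.007hs)²)^{-3/2}·8hs·hs` each
(`Theorems.StadiumQuarterDescentBound`), and the two plateau halves `[z − hs/5, z]`, `[z, z + hs/5]`, each `O(log hs/hs)` by the relative margin `21/25`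
(`Theorems.StadiumQuarterPlateauBound.quarter_plateau_re_ge`), the pointwise majorant `Theorems.StadiumPlateauKernel.plateau_kernel_norm_le` and the
abstract `O(log)` integration `Theorems.StadiumPlateauLog.plateau_integral_norm_le` in the segment parameter `t ∈ [0,1]` (`plateau_left_half_norm_le`,
`plateau_right_half_norm_le`; log-condition `√(κ/(2Λ)) ≤ √(21/25)·hs/5`).  `own_tent_norm_le` adds them up — the BOUND CLAUSE of the own term of `rcore`
(holomorphy: `Theorems.StadiumTentNhds`; real trace: `Theorems.StadiumTentReal`).
HONEST FRAMING: bookkeeping for a HYPOTHETICAL filament skeleton on the NEGATIVE side of a MODEL route; the stub `stub_stripPropagation` is NOT closed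
by this file (the per-filament core with partners and the Γ-asymptotics remain), `TangentSkeletonNearStraightL` / `SkeletonJ1L` stay OPEN; nothing
here bears on Navier–Stokes regularity or blow-up.  `--supports stmt-NavierStokesRegularity-23320` (≡ stub `stub_tangentSkeletonL` of 23296).
-/

set_option linter.dupNamespace false

noncomputable section

namespace Summit.NavierStokesRegularity.NavierStokesRegularity.Theorems.StadiumOwnTentBound

open Set Complex MeasureTheory Metric Finset
open scoped InnerProductSpace Matrix Interval
open Summit.NavierStokesRegularity.NavierStokesRegularity.Theorems.StadiumQuarterDescentBound
open Summit.NavierStokesRegularity.NavierStokesRegularity.Theorems.StadiumQuarterPlateauBound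
open Summit.NavierStokesRegularity.NavierStokesRegularity.Theorems.StadiumQuarterOwnFeet
open Summit.NavierStokesRegularity.NavierStokesRegularity.Theorems.StadiumPlateauKernel
open Summit.NavierStokesRegularity.NavierStokesRegularity.Theorems.StadiumPlateauLog
open Summit.NavierStokesRegularity.NavierStokesRegularity.Theorems.StadiumPartnerPiece

/-- **Pointwise majorant on the plateau of the symmetric tent, segment parameter.**  Target `z ∈ Q`, source `z + s` with `|s| ≤ hs/5`:
`‖K(z, z + s)‖ ≤ ((21/25)s² + κ/(2Λ))^{-3/2}·(2·2·(2/(hs/2))·s²)`. [folklore] -/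
theorem plateau_point_norm_le {hs L cc κ Λ : ℝ} {F : ℂ → (Fin 3 → ℂ)} {G : ℂ → ℂ}
    (hF : DifferentiableOn ℂ F {z : ℂ | |z.im| < hs ∧ |z.re - cc| < L + hs})
    (hM : ∀ z ∈ {z : ℂ | |z.im| < hs ∧ |z.re - cc| < L + hs}, ‖deriv F z‖ ≤ 2)
    (hunit : ∀ w ∈ {z : ℂ | |z.im| < hs ∧ |z.re - cc| < L + hs}, ∑ i, (deriv F w i) ^ 2 = 1)
    (hGre : ∀ w ∈ {z : ℂ | |z.im| < hs ∧ |z.re - cc| < L + hs}, Λ⁻¹ / 2 ≤ (G w).re)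
    (hκ : 0 < κ) (hΛ : 0 < Λ) (hhs : 0 < hs) {z : ℂ} (hy : |z.im| < hs / 4) (hτ : |z.re - cc| < L + hs / 4)
    {s : ℝ} (hs5 : |s| ≤ hs / 5) :
    ‖(((∑ i, (F z i - F (z + (s : ℂ)) i) ^ 2) + (κ : ℂ) * G (z + (s : ℂ))) ^ ((3:ℂ) / 2))⁻¹ •
        (deriv F (z + (s : ℂ)) ⨯₃ (fun i => F z i - F (z + (s : ℂ)) i))‖ ≤
      ((21 / 25 : ℝ) * s ^ 2 + κ / (2 * Λ)) ^ (-(3/2 : ℝ)) * (2 * 2 * (2 / (hs / 2)) * s ^ 2) := by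
  set S : Set ℂ := {z : ℂ | |z.im| < hs ∧ |z.re - cc| < L + hs} with hS
  have hSo : IsOpen S := isOpen_stadium hs (L + hs) cc
  set τ : ℝ := z.re with hτdef
  set y : ℝ := z.im with hydef
  have ez : (τ : ℂ) + (y : ℂ) * Complex.I = z := Complex.re_add_im z
  have hs' := abs_le.mp hs5
  have hab : τ - hs / 5 ≤ τ + hs / 5 := by linarith
  have huIcc : Set.uIcc (τ - hs / 5) (τ + hs / 5) = Icc (τ - hs / 5) (τ + hs / 5) := uIcc_of_le hab
  have hdisc : ∀ σ ∈ Set.uIcc (τ - hs / 5) (τ + hs / 5), closedBall ((σ : ℂ) + (y : ℂ) * Complex.I) (hs / 2) ⊆ S := fun σ hσ =>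
    closedBall_plateau_subset hhs hy hτ hσ
  have hR₀ : (0:ℝ) < hs / 2 := by positivity
  have hτ' : τ ∈ Set.uIcc (τ - hs / 5) (τ + hs / 5) := by rw [huIcc]; exact ⟨by linarith, by linarith⟩
  have hσ' : τ + s ∈ Set.uIcc (τ - hs / 5) (τ + hs / 5) := by rw [huIcc]; exact ⟨by linarith, by linarith⟩
  have hQ : (21 / 25 : ℝ) * (τ + s - τ) ^ 2 ≤ (∑ i, (F (((τ : ℂ) + (y : ℂ) * Complex.I) + ((τ + s - τ : ℝ) : ℂ)) i -
      F ((τ : ℂ) + (y : ℂ) * Complex.I) i) ^ 2).re := by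
    rw [show τ + s - τ = s by ring, ez]
    exact quarter_plateau_re_ge hF hM hunit hhs hy hτ hs5
  have ept : ((τ + s : ℝ) : ℂ) + (y : ℂ) * Complex.I = z + (s : ℂ) := by rw [← ez]; push_cast; ring
  have hmem : z + (s : ℂ) ∈ S := by rw [← ept]; exact hdisc (τ + s) hσ' (mem_closedBall_self hR₀.le)
  have hk := plateau_kernel_norm_le hSo hF hM hR₀ hdisc hτ' hσ' hκ hΛ (le_refl Λ⁻¹) (by norm_num : (0:ℝ) ≤ 21 / 25)
    (hGre _ hmem) hQ
  rw [show τ + s - τ = s by ring, ez] at hk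
  have e1 : (∑ i, (F (z + (s : ℂ)) i - F z i) ^ 2) = ∑ i, (F z i - F (z + (s : ℂ)) i) ^ 2 :=
    Finset.sum_congr rfl fun i _ => by ring
  have e2 : (F z - F (z + (s : ℂ))) = fun i => F z i - F (z + (s : ℂ)) i := by funext i; simp [Pi.sub_apply]
  rw [e1, e2] at hk
  exact hk

/-- **Left half of the plateau, segment form**: `‖∫₀¹ (hs/5) • K(z, (z − hs/5) + t·hs/5) dt‖ = O(log hs/hs)` under the log-condition
`√(κ/(2Λ))/√((21/25)(hs/5)²) ≤ 1`. [folklore] -/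
theorem plateau_left_half_norm_le {hs L cc κ Λ : ℝ} {F : ℂ → (Fin 3 → ℂ)} {G : ℂ → ℂ}
    (hF : DifferentiableOn ℂ F {z : ℂ | |z.im| < hs ∧ |z.re - cc| < L + hs})
    (hM : ∀ z ∈ {z : ℂ | |z.im| < hs ∧ |z.re - cc| < L + hs}, ‖deriv F z‖ ≤ 2)
    (hunit : ∀ w ∈ {z : ℂ | |z.im| < hs ∧ |z.re - cc| < L + hs}, ∑ i, (deriv F w i) ^ 2 = 1)
    (hGre : ∀ w ∈ {z : ℂ | |z.im| < hs ∧ |z.re - cc| < L + hs}, Λ⁻¹ / 2 ≤ (G w).re)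
    (hκ : 0 < κ) (hΛ : 0 < Λ) (hhs : 0 < hs) {z : ℂ} (hy : |z.im| < hs / 4) (hτ : |z.re - cc| < L + hs / 4)
    (hR : √(κ / (2 * Λ)) / √((21 / 25 : ℝ) * (hs / 5) ^ 2) ≤ 1 - 0) :
    ‖∫ t in (0:ℝ)..1, (z - (z - ((hs / 5 : ℝ) : ℂ))) •
        ((((∑ i, (F z i - F ((z - ((hs / 5 : ℝ) : ℂ)) + (t : ℂ) * (z - (z - ((hs / 5 : ℝ) : ℂ)))) i) ^ 2) +
            (κ : ℂ) * G ((z - ((hs / 5 : ℝ) : ℂ)) + (t : ℂ) * (z - (z - ((hs / 5 : ℝ) : ℂ))))) ^ ((3:ℂ) / 2))⁻¹ •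
          (deriv F ((z - ((hs / 5 : ℝ) : ℂ)) + (t : ℂ) * (z - (z - ((hs / 5 : ℝ) : ℂ)))) ⨯₃
            (fun i => F z i - F ((z - ((hs / 5 : ℝ) : ℂ)) + (t : ℂ) * (z - (z - ((hs / 5 : ℝ) : ℂ)))) i)))‖ ≤
      4 * (2 * ((2 / (hs / 2)) * (hs / 5) ^ 3)) * ((1/3 + Real.log ((1 - 0) * √((21 / 25 : ℝ) * (hs / 5) ^ 2) / √(κ / (2 * Λ)))) /
        ((21 / 25 : ℝ) * (hs / 5) ^ 2) ^ (3/2 : ℝ)) := by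
  set μ : ℝ := √(κ / (2 * Λ)) with hμdef
  have hμpos : 0 < μ := Real.sqrt_pos.2 (by positivity)
  have hμsq : μ ^ 2 = κ / (2 * Λ) := Real.sq_sqrt (by positivity)
  set c' : ℝ := (21 / 25 : ℝ) * (hs / 5) ^ 2 with hc'
  have hc : 0 < c' := by positivity
  have hBK : 0 ≤ 2 * ((2 / (hs / 2)) * (hs / 5) ^ 3) := by positivity
  have hpt : ∀ t : ℝ, (z - ((hs / 5 : ℝ) : ℂ)) + (t : ℂ) * (z - (z - ((hs / 5 : ℝ) : ℂ))) = z + (((hs / 5) * (t - 1) : ℝ) : ℂ) := by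
    intro t; push_cast; ring
  have hdom : ∀ t ∈ Icc (0:ℝ) 1, ‖(z - (z - ((hs / 5 : ℝ) : ℂ))) •
        ((((∑ i, (F z i - F ((z - ((hs / 5 : ℝ) : ℂ)) + (t : ℂ) * (z - (z - ((hs / 5 : ℝ) : ℂ)))) i) ^ 2) +
            (κ : ℂ) * G ((z - ((hs / 5 : ℝ) : ℂ)) + (t : ℂ) * (z - (z - ((hs / 5 : ℝ) : ℂ))))) ^ ((3:ℂ) / 2))⁻¹ •
          (deriv F ((z - ((hs / 5 : ℝ) : ℂ)) + (t : ℂ) * (z - (z - ((hs / 5 : ℝ) : ℂ)))) ⨯₃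
            (fun i => F z i - F ((z - ((hs / 5 : ℝ) : ℂ)) + (t : ℂ) * (z - (z - ((hs / 5 : ℝ) : ℂ)))) i)))‖ ≤
      (c' * (t - 1) ^ 2 + μ ^ 2) ^ (-(3/2 : ℝ)) * (2 * 2 * ((2 / (hs / 2)) * (hs / 5) ^ 3) * (t - 1) ^ 2) := by
    intro t ht
    rw [hpt t, norm_smul]
    have hs5 : |(hs / 5) * (t - 1)| ≤ hs / 5 := by
      rw [abs_mul, abs_of_pos (by positivity : (0:ℝ) < hs / 5)]
      have : |t - 1| ≤ 1 := by rw [abs_le]; constructor <;> linarith [ht.1, ht.2]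
      nlinarith
    have hk := plateau_point_norm_le hF hM hunit hGre hκ hΛ hhs hy hτ hs5
    have hn : ‖z - (z - ((hs / 5 : ℝ) : ℂ))‖ = hs / 5 := by
      rw [show z - (z - ((hs / 5 : ℝ) : ℂ)) = ((hs / 5 : ℝ) : ℂ) by ring, Complex.norm_real, Real.norm_eq_abs,
        abs_of_pos (by positivity)]
    rw [hn]
    have e1 : (21 / 25 : ℝ) * ((hs / 5) * (t - 1)) ^ 2 + κ / (2 * Λ) = c' * (t - 1) ^ 2 + μ ^ 2 := by
      rw [hμsq, hc']; ring
    rw [e1] at hk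
    have hpow0 : 0 ≤ (c' * (t - 1) ^ 2 + μ ^ 2) ^ (-(3/2 : ℝ)) := Real.rpow_nonneg (by positivity) _
    calc hs / 5 * ‖(((∑ i, (F z i - F (z + ((((hs / 5) * (t - 1) : ℝ)) : ℂ)) i) ^ 2) +
            (κ : ℂ) * G (z + ((((hs / 5) * (t - 1) : ℝ)) : ℂ))) ^ ((3:ℂ) / 2))⁻¹ •
          (deriv F (z + ((((hs / 5) * (t - 1) : ℝ)) : ℂ)) ⨯₃ (fun i => F z i - F (z + ((((hs / 5) * (t - 1) : ℝ)) : ℂ)) i))‖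
        ≤ hs / 5 * ((c' * (t - 1) ^ 2 + μ ^ 2) ^ (-(3/2 : ℝ)) * (2 * 2 * (2 / (hs / 2)) * ((hs / 5) * (t - 1)) ^ 2)) :=
          mul_le_mul_of_nonneg_left hk (by positivity)
      _ = (c' * (t - 1) ^ 2 + μ ^ 2) ^ (-(3/2 : ℝ)) * (2 * 2 * ((2 / (hs / 2)) * (hs / 5) ^ 3) * (t - 1) ^ 2) := by ring
  have h := plateau_integral_norm_le (E := Fin 3 → ℂ) (a := 0) (b := 1) (τ := 1) zero_le_one ⟨zero_le_one, le_rfl⟩ hc hμpos hR hBK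
    hdom
  exact h

/-- **Right half of the plateau, segment form**: `‖∫₀¹ (hs/5) • K(z, z + t·hs/5) dt‖ = O(log hs/hs)` under the same log-condition. [folklore] -/
theorem plateau_right_half_norm_le {hs L cc κ Λ : ℝ} {F : ℂ → (Fin 3 → ℂ)} {G : ℂ → ℂ}
    (hF : DifferentiableOn ℂ F {z : ℂ | |z.im| < hs ∧ |z.re - cc| < L + hs})
    (hM : ∀ z ∈ {z : ℂ | |z.im| < hs ∧ |z.re - cc| < L + hs}, ‖deriv F z‖ ≤ 2)
    (hunit : ∀ w ∈ {z : ℂ | |z.im| < hs ∧ |z.re - cc| < L + hs}, ∑ i, (deriv F w i) ^ 2 = 1)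
    (hGre : ∀ w ∈ {z : ℂ | |z.im| < hs ∧ |z.re - cc| < L + hs}, Λ⁻¹ / 2 ≤ (G w).re)
    (hκ : 0 < κ) (hΛ : 0 < Λ) (hhs : 0 < hs) {z : ℂ} (hy : |z.im| < hs / 4) (hτ : |z.re - cc| < L + hs / 4)
    (hR : √(κ / (2 * Λ)) / √((21 / 25 : ℝ) * (hs / 5) ^ 2) ≤ 1 - 0) :
    ‖∫ t in (0:ℝ)..1, ((z + ((hs / 5 : ℝ) : ℂ)) - z) •
        ((((∑ i, (F z i - F (z + (t : ℂ) * ((z + ((hs / 5 : ℝ) : ℂ)) - z)) i) ^ 2) +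
            (κ : ℂ) * G (z + (t : ℂ) * ((z + ((hs / 5 : ℝ) : ℂ)) - z))) ^ ((3:ℂ) / 2))⁻¹ •
          (deriv F (z + (t : ℂ) * ((z + ((hs / 5 : ℝ) : ℂ)) - z)) ⨯₃
            (fun i => F z i - F (z + (t : ℂ) * ((z + ((hs / 5 : ℝ) : ℂ)) - z)) i)))‖ ≤
      4 * (2 * ((2 / (hs / 2)) * (hs / 5) ^ 3)) * ((1/3 + Real.log ((1 - 0) * √((21 / 25 : ℝ) * (hs / 5) ^ 2) / √(κ / (2 * Λ)))) /
        ((21 / 25 : ℝ) * (hs / 5) ^ 2) ^ (3/2 : ℝ)) := by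
  set μ : ℝ := √(κ / (2 * Λ)) with hμdef
  have hμpos : 0 < μ := Real.sqrt_pos.2 (by positivity)
  have hμsq : μ ^ 2 = κ / (2 * Λ) := Real.sq_sqrt (by positivity)
  set c' : ℝ := (21 / 25 : ℝ) * (hs / 5) ^ 2 with hc'
  have hc : 0 < c' := by positivity
  have hBK : 0 ≤ 2 * ((2 / (hs / 2)) * (hs / 5) ^ 3) := by positivity
  have hpt : ∀ t : ℝ, z + (t : ℂ) * ((z + ((hs / 5 : ℝ) : ℂ)) - z) = z + (((hs / 5) * (t - 0) : ℝ) : ℂ) := by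
    intro t; push_cast; ring
  have hdom : ∀ t ∈ Icc (0:ℝ) 1, ‖((z + ((hs / 5 : ℝ) : ℂ)) - z) •
        ((((∑ i, (F z i - F (z + (t : ℂ) * ((z + ((hs / 5 : ℝ) : ℂ)) - z)) i) ^ 2) +
            (κ : ℂ) * G (z + (t : ℂ) * ((z + ((hs / 5 : ℝ) : ℂ)) - z))) ^ ((3:ℂ) / 2))⁻¹ •
          (deriv F (z + (t : ℂ) * ((z + ((hs / 5 : ℝ) : ℂ)) - z)) ⨯₃
            (fun i => F z i - F (z + (t : ℂ) * ((z + ((hs / 5 : ℝ) : ℂ)) - z)) i)))‖ ≤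
      (c' * (t - 0) ^ 2 + μ ^ 2) ^ (-(3/2 : ℝ)) * (2 * 2 * ((2 / (hs / 2)) * (hs / 5) ^ 3) * (t - 0) ^ 2) := by
    intro t ht
    rw [hpt t, norm_smul]
    have hs5 : |(hs / 5) * (t - 0)| ≤ hs / 5 := by
      rw [abs_mul, abs_of_pos (by positivity : (0:ℝ) < hs / 5)]
      have : |t - 0| ≤ 1 := by rw [abs_le]; constructor <;> linarith [ht.1, ht.2]
      nlinarith
    have hk := plateau_point_norm_le hF hM hunit hGre hκ hΛ hhs hy hτ hs5
    have hn : ‖(z + ((hs / 5 : ℝ) : ℂ)) - z‖ = hs / 5 := by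
      rw [show (z + ((hs / 5 : ℝ) : ℂ)) - z = ((hs / 5 : ℝ) : ℂ) by ring, Complex.norm_real, Real.norm_eq_abs,
        abs_of_pos (by positivity)]
    rw [hn]
    have e1 : (21 / 25 : ℝ) * ((hs / 5) * (t - 0)) ^ 2 + κ / (2 * Λ) = c' * (t - 0) ^ 2 + μ ^ 2 := by
      rw [hμsq, hc']; ring
    rw [e1] at hk
    calc hs / 5 * ‖(((∑ i, (F z i - F (z + ((((hs / 5) * (t - 0) : ℝ)) : ℂ)) i) ^ 2) +
            (κ : ℂ) * G (z + ((((hs / 5) * (t - 0) : ℝ)) : ℂ))) ^ ((3:ℂ) / 2))⁻¹ •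
          (deriv F (z + ((((hs / 5) * (t - 0) : ℝ)) : ℂ)) ⨯₃ (fun i => F z i - F (z + ((((hs / 5) * (t - 0) : ℝ)) : ℂ)) i))‖
        ≤ hs / 5 * ((c' * (t - 0) ^ 2 + μ ^ 2) ^ (-(3/2 : ℝ)) * (2 * 2 * (2 / (hs / 2)) * ((hs / 5) * (t - 0)) ^ 2)) :=
          mul_le_mul_of_nonneg_left hk (by positivity)
      _ = (c' * (t - 0) ^ 2 + μ ^ 2) ^ (-(3/2 : ℝ)) * (2 * 2 * ((2 / (hs / 2)) * (hs / 5) ^ 3) * (t - 0) ^ 2) := by ring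
  have h := plateau_integral_norm_le (E := Fin 3 → ℂ) (a := 0) (b := 1) (τ := 0) zero_le_one ⟨le_rfl, zero_le_one⟩ hc hμpos hR hBK
    hdom
  exact h

/-- **The explicit bound of the symmetric tent field (own term of `rcore`).**  Stadium data as in `Theorems.StadiumTentNhds` plus the core floor
`Re G ≥ Λ⁻¹/2` on `S` and the plateau log-condition; kernels `f`, `g` and tent vertices `V` by their defining equations; target `z ∈ Q`.  Then the tent
field at `z` is bounded by two feet + two sloped segments + two plateau halves, explicitly. [folklore] -/
theorem own_tent_norm_le {hs L cc κ Λ : ℝ} {F : ℂ → (Fin 3 → ℂ)} {G : ℂ → ℂ}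
    (hF : DifferentiableOn ℂ F {z : ℂ | |z.im| < hs ∧ |z.re - cc| < L + hs})
    (hM : ∀ z ∈ {z : ℂ | |z.im| < hs ∧ |z.re - cc| < L + hs}, ‖deriv F z‖ ≤ 2)
    (hunit : ∀ w ∈ {z : ℂ | |z.im| < hs ∧ |z.re - cc| < L + hs}, ∑ i, (deriv F w i) ^ 2 = 1)
    {X : ℝ → EuclideanSpace ℝ (Fin 3)} (hX : ContDiff ℝ 1 X) (hXu : ∀ τ, ‖deriv X τ‖ = 1)
    {Rb : ℝ} (hRb0 : 0 ≤ Rb) (hRb : Rb ≤ 1 / 2) (hosc : ∀ τ σ, ‖deriv X τ - deriv X σ‖ ≤ Rb)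
    (hFX : ∀ r : ℝ, (r : ℂ) ∈ {z : ℂ | |z.im| < hs ∧ |z.re - cc| < L + hs} →
      F r = fun i => ((⟪X r, EuclideanSpace.single i (1:ℝ)⟫_ℝ : ℝ) : ℂ))
    {A : ℝ → ℝ} (hAc : Continuous A) (hA0 : ∀ σ, 0 ≤ A σ)
    (hGre : ∀ w ∈ {z : ℂ | |z.im| < hs ∧ |z.re - cc| < L + hs}, Λ⁻¹ / 2 ≤ (G w).re)
    (hκ : 0 < κ) (hΛ : 0 < Λ) (hhs : 0 < hs)
    (hR : √(κ / (2 * Λ)) / √((21 / 25 : ℝ) * (hs / 5) ^ 2) ≤ 1 - 0)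
    {f : ℂ → ℂ → (Fin 3 → ℂ)}
    (hf : ∀ z ζ, f z ζ = (((∑ i, (F z i - F ζ i) ^ 2) + (κ : ℂ) * G ζ) ^ ((3:ℂ) / 2))⁻¹ •
      (deriv F ζ ⨯₃ (fun i => F z i - F ζ i)))
    {g : ℂ → ℝ → (Fin 3 → ℂ)}
    (hg : ∀ z σ, g z σ = (((∑ i, (F z i - ((X σ i : ℝ) : ℂ)) ^ 2) + ((κ * A σ : ℝ) : ℂ)) ^ ((3:ℂ) / 2))⁻¹ •
      ((fun i => ((deriv X σ i : ℝ) : ℂ)) ⨯₃ (fun i => F z i - ((X σ i : ℝ) : ℂ))))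
    {V : ℂ → ℕ → ℂ}
    (hV0 : ∀ z, V z 0 = ((z.re - hs / 2 : ℝ) : ℂ)) (hV1 : ∀ z, V z 1 = z - ((hs / 5 : ℝ) : ℂ)) (hV2 : ∀ z, V z 2 = z)
    (hV3 : ∀ z, V z 3 = z + ((hs / 5 : ℝ) : ℂ)) (hV4 : ∀ z, V z 4 = ((z.re + hs / 2 : ℝ) : ℂ))
    {z : ℂ} (hy : |z.im| < hs / 4) (hτ : |z.re - cc| < L + hs / 4) :
    ‖(∫ σ in Iic (z.re - hs / 2), g z σ) +
        (∑ k ∈ range 4, ∫ t in (0:ℝ)..1, (V z (k+1) - V z k) • f z (V z k + (t : ℂ) * (V z (k+1) - V z k))) +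
        ∫ σ in Ioi (z.re + hs / 2), g z σ‖ ≤
      2 * (160 * (Real.pi / (1 * (hs / 2)))) + 2 * (((0.007 * hs) ^ 2) ^ (-(3/2 : ℝ)) * (8 * hs) * hs) +
        2 * (4 * (2 * ((2 / (hs / 2)) * (hs / 5) ^ 3)) *
          ((1/3 + Real.log ((1 - 0) * √((21 / 25 : ℝ) * (hs / 5) ^ 2) / √(κ / (2 * Λ)))) / ((21 / 25 : ℝ) * (hs / 5) ^ 2) ^ (3/2 : ℝ))) := by
  set S : Set ℂ := {z : ℂ | |z.im| < hs ∧ |z.re - cc| < L + hs} with hS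
  have hgz : ∀ z, g z = fun σ => (((∑ i, (F z i - ((X σ i : ℝ) : ℂ)) ^ 2) + ((κ * A σ : ℝ) : ℂ)) ^ ((3:ℂ) / 2))⁻¹ •
      ((fun i => ((deriv X σ i : ℝ) : ℂ)) ⨯₃ (fun i => F z i - ((X σ i : ℝ) : ℂ))) := fun z => funext (hg z)
  have ez : (z.re : ℂ) + (z.im : ℂ) * Complex.I = z := Complex.re_add_im z
  have hG0 : ∀ w ∈ S, 0 ≤ (G w).re := fun w hw => le_trans (by positivity) (hGre w hw)
  -- the feet
  obtain ⟨-, hfR⟩ := own_foot_right hF hM hunit hX hXu hRb0 hRb hosc hFX hAc hA0 hκ.le hhs hy hτ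
  obtain ⟨-, hfL⟩ := own_foot_left hF hM hunit hX hXu hRb0 hRb hosc hFX hAc hA0 hκ.le hhs hy hτ
  have hR' : ‖∫ σ in Ioi (z.re + hs / 2), g z σ‖ ≤ 160 * (Real.pi / (1 * (hs / 2))) := by
    rw [hgz, ← integral_Ici_eq_integral_Ioi]; exact hfR
  have hL' : ‖∫ σ in Iic (z.re - hs / 2), g z σ‖ ≤ 160 * (Real.pi / (1 * (hs / 2))) := by
    rw [hgz]; exact hfL
  -- the sloped segments
  have h0 := left_ascent_segment_norm_le hF hM hunit hX hXu hRb0 hRb hosc hFX hhs hy hτ hκ.le hG0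
  have h3 := right_descent_segment_norm_le hF hM hunit hX hXu hRb0 hRb hosc hFX hhs hy hτ hκ.le hG0
  rw [ez] at h0 h3
  -- the plateau halves
  have h1 := plateau_left_half_norm_le hF hM hunit hGre hκ hΛ hhs hy hτ hR
  have h2 := plateau_right_half_norm_le hF hM hunit hGre hκ hΛ hhs hy hτ hR
  have e1 : z - ((hs / 5 : ℝ) : ℂ) = ((z.re - hs / 5 : ℝ) : ℂ) + (z.im : ℂ) * Complex.I := by
    apply Complex.ext <;> simp
  have e3 : z + ((hs / 5 : ℝ) : ℂ) = ((z.re + hs / 5 : ℝ) : ℂ) + (z.im : ℂ) * Complex.I := by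
    apply Complex.ext <;> simp
  rw [e1] at h1
  rw [e3] at h2
  -- unfold the tent
  rw [Finset.sum_range_succ, Finset.sum_range_succ, Finset.sum_range_succ, Finset.sum_range_succ, Finset.sum_range_zero, zero_add]
  simp only [hV0, hV1, hV2, hV3, hV4, hf]
  rw [e1, e3]
  have key : ∀ (a s0 s1 s2 s3 b : Fin 3 → ℂ), ‖a + (s0 + s1 + s2 + s3) + b‖ ≤ ‖a‖ + ‖s0‖ + ‖s1‖ + ‖s2‖ + ‖s3‖ + ‖b‖ := by
    intro a s0 s1 s2 s3 b
    have h5 := norm_add_le (a + (s0 + s1 + s2 + s3)) b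
    have h4 := norm_add_le a (s0 + s1 + s2 + s3)
    have h33 := norm_add_le (s0 + s1 + s2) s3
    have h22 := norm_add_le (s0 + s1) s2
    have h11 := norm_add_le s0 s1
    linarith
  refine (key _ _ _ _ _ _).trans ?_
  linarith [hL', h0, h1, h2, h3, hR']

end Summit.NavierStokesRegularity.NavierStokesRegularity.Theorems.StadiumOwnTentBound

end
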